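import Literature.AlgebraicGeometry.Resolution.AlterationsGenericallyEtaleSeparable
import Literature.AlgebraicGeometry.Resolution.EtaleOverNhd
import Literature.AlgebraicGeometry.Resolution.EtaleNhdOfFlatUnramifiedPoint
import Mathlib.AlgebraicGeometry.Morphisms.QuasiFinite
import Mathlib.FieldTheory.Perfect
import HarnessLib

/-!
# A separable alteration is étale over a dense open of the target (de Jong 1996, 2.20, "⇐")

Topic `Literature/AlgebraicGeometry/Resolution`; sequel of `AlterationsGenericallyEtaleSeparable.lean`,
which proves de Jong 1996, 2.20 in the direction "generically étale ⇒ `K(X) ⊂ K(X₁)` separable" and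
leaves the converse as a TODO. This file proves the converse by SPREADING OUT AN ÉTALE GENERIC FIBRE
(EGA IV₄ 17.6.1 c) ⇒ a)), in the strong, target-sided form that consumers want:

* `exists_etale_morphismRestrict_of_formallyUnramified_stalkMap_genericPoint` — the scheme-theoretic
  core, a «generalise-then-specialise» edition of ★
  `HodgeTheory/GenericEtalenessOfDegree.exists_etale_morphismRestrict_of_map_primeCycle_eq_nsmul` with
  the smooth-projective / cycle-degree bookkeeping replaced by its actual inputs: for a dominant,
  universally closed morphism `φ : X₁ → X` of integral schemes, locally of finite presentation, whose
  generic point `θ` is the ONLY point over the generic point `ω` of `X` and whose stalk map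
  `𝒪_{X,ω} = K(X) → 𝒪_{X₁,θ} = K(X₁)` is formally unramified, `φ` is ÉTALE over an open `V ∋ ω`
  (the stalk map is a map of fields, hence flat; EGA IV₄ 17.6.1 ★
  `exists_etale_ι_comp_of_flat_of_formallyUnramified_stalkMap` makes `φ` étale on an open `O ∋ θ`;
  `φ` closed and `φ⁻¹(ω) = {θ} ⊆ O` give `V` by ★ `exists_etale_morphismRestrict_of_forall_exists_opens`);
* `formallyUnramified_stalkMap_genericPoint_of_formallyUnramified` — `K(X₁)/K(X)` formally unramified
  (e.g. separable) ⇒ the stalk map at `θ` is formally unramified (the two maps agree up to the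
  isomorphisms `𝒪_{X,φ θ} ≅ K(X)`, `𝒪_{X₁,θ} = K(X₁)`);
* `IsAlteration.eq_genericPoint_of_base_eq_genericPoint` — for an alteration `φ⁻¹(ω) = {θ}` (finite
  over an open `U ∋ ω`: the fibre is discrete and every point is a specialisation of `θ`);
* `IsAlteration.exists_isFinite_etale_morphismRestrict_of_isSeparable` — **a separable alteration is
  FINITE ÉTALE over a non-empty open of the target** (de Jong 1996, 2.20 "⇐", target form);
* `IsAlteration.isGenericallyEtale_of_isSeparable`, `IsAlteration.isGenericallyEtale_iff_isSeparable` —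
  de Jong 1996, 2.20 as an `iff` with ★ `IsAlteration.isSeparable_of_isGenericallyEtale`;
* `IsAlteration.isSeparable_of_perfectField`, `…exists_isFinite_etale_morphismRestrict_of_perfectField`,
  `…_of_charZero` — over a perfect (e.g. characteristic-`0`) function field every alteration is
  separable (Mathlib `Algebra.IsAlgebraic.isSeparable_of_perfectField`), hence finite étale over a
  non-empty open of the target: the form used for "a general fibre of a generically finite dominant
  morphism in characteristic `0` is reduced" (Harris, *Algebraic Geometry*, Prop. 7.16).

## References

* [DeJong1996] A. J. de Jong, *Smoothness, semi-stability and alterations*, Publ. Math. IHÉS 83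
  (1996), 2.20, p. 61: "We remark that an alteration `S' → S` is generically étale if and only if the
  (finite) extension of function fields `R(S) ⊂ R(S')` is separable."
* [Grothendieck1967] A. Grothendieck, J. Dieudonné, EGA IV₄, Publ. Math. IHÉS 32 (1967), Thm. 17.6.1
  c) ⇒ a).
* [Harris1992] J. Harris, *Algebraic Geometry: A First Course*, GTM 133 (1992), Prop. 7.16.
-/

noncomputable section

open CategoryTheory AlgebraicGeometry TopologicalSpace

namespace Literature.AlgebraicGeometry.Resolution

universe u

open Literature.AlgebraicGeometry.Motives Literature.AlgebraicGeometry.Motives.RatFn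

variable {X₁ X : Scheme.{u}}

/-! ## Bookkeeping -/

/-- A property local on the target passes from `f ∣_ U` to `f ∣_ V` for `V ≤ U` (private copy of
`Morphisms/IsoOverOpen.of_morphismRestrict_of_le`, to keep the imports of this file light). [folklore] -/
private theorem of_morphismRestrict_of_le' (P : MorphismProperty Scheme.{u})
    [IsZariskiLocalAtTarget P] (f : X₁ ⟶ X) {U V : X.Opens} (hUV : V ≤ U) (hf : P (f ∣_ U)) :
    P (f ∣_ V) := by
  have h1 : P ((f ∣_ U) ∣_ (U.ι ⁻¹ᵁ V)) := IsZariskiLocalAtTarget.restrict hf _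
  have h2 : P (f ∣_ (U.ι ''ᵁ (U.ι ⁻¹ᵁ V))) :=
    (P.arrow_mk_iso_iff (morphismRestrictRestrict f U (U.ι ⁻¹ᵁ V))).mp h1
  have hV : U.ι ''ᵁ (U.ι ⁻¹ᵁ V) = V := by
    rw [Scheme.Hom.image_preimage_eq_opensRange_inf, Scheme.Opens.opensRange_ι, inf_eq_right]
    exact hUV
  exact (P.arrow_mk_iso_iff (morphismRestrictEq f hV)).mp h2

/-- The generic point of an irreducible scheme lies in every non-empty open. [folklore] -/
private theorem genericPoint_mem_opens_of_nonempty_aux [IrreducibleSpace X] (U : X.Opens)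
    (hU : (U : Set X).Nonempty) : genericPoint X ∈ U :=
  ((genericPoint_spec X).mem_open_set_iff U.2).mpr (by simpa using hU)

/-! ## The scheme-theoretic core: spreading out an étale generic fibre -/

/-- **Étale over a neighbourhood of the generic point of the target, from a formally unramified
stalk map at the generic point of the source** (EGA IV₄ 17.6.1 c) ⇒ a), spread over the base; the
«generalise-then-specialise» edition of ★ `exists_etale_morphismRestrict_of_map_primeCycle_eq_nsmul`).
Let `φ : X₁ → X` be a dominant, universally closed morphism of integral schemes, locally of finite
presentation, such that the generic point `θ` of `X₁` is the only point of `X₁` over the generic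
point `ω` of `X`, and such that the stalk map `𝒪_{X, ω} → 𝒪_{X₁, θ} = K(X₁)` is formally unramified.
Then `φ` is étale over an open neighbourhood `V` of `ω`.  Proof: `𝒪_{X, φ θ}` is a field (the local
ring at a generic point), so the stalk map at `θ` is flat; by EGA IV₄ 17.6.1 `φ` is étale on an open
`O ∋ θ`; as `φ⁻¹(ω) = {θ} ⊆ O` and `φ` is closed, `V := X ∖ φ(X₁ ∖ O)` works.
[cite: Grothendieck1967, Thm. 17.6.1 c)⇒a)] [cite: DeJong1996, 2.20, p. 61] -/
theorem exists_etale_morphismRestrict_of_formallyUnramified_stalkMap_genericPoint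
    [IsIntegral X₁] [IsIntegral X] (φ : X₁ ⟶ X) [IsDominant φ] [UniversallyClosed φ]
    [LocallyOfFinitePresentation φ]
    (hfib : ∀ z : X₁, φ.base z = genericPoint X → z = genericPoint X₁)
    (hur : (φ.stalkMap (genericPoint X₁)).hom.FormallyUnramified) :
    ∃ V : X.Opens, genericPoint X ∈ V ∧ Etale (φ ∣_ V) := by
  have hθ : φ.base (genericPoint X₁) = genericPoint X := genericPoint_eq_of_isDominant φ
  -- the local ring of `X` at `φ θ = ω` is a field, so the stalk map at `θ` is flat
  have hF : IsField (X.presheaf.stalk (φ.base (genericPoint X₁))) :=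
    isField_stalk_of_closure_mem_irreducibleComponents X _ (by
      rw [hθ, irreducibleComponents_eq_singleton]
      simp)
  have hfl : (φ.stalkMap (genericPoint X₁)).hom.Flat := RingHom.Flat.of_isField hF _
  -- EGA IV₄ 17.6.1 c)⇒a): étale on an open neighbourhood `O` of `θ`
  obtain ⟨O, hθO, hO⟩ :=
    exists_etale_ι_comp_of_flat_of_formallyUnramified_stalkMap φ (genericPoint X₁) hfl hur
  -- spread over the base: `θ` is the only point over `ω` and `φ` is closed
  obtain ⟨V, hV, hVet⟩ := exists_etale_morphismRestrict_of_forall_exists_opens φ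
    (φ.base (genericPoint X₁)) fun z hz => ⟨O, (hfib z (hz.trans hθ)).symm ▸ hθO, hO⟩
  exact ⟨V, hθ ▸ hV, hVet⟩

/-- **A formally unramified function field extension gives a formally unramified stalk map at the
generic point.**  For a dominant morphism `φ : X₁ → X` of integral schemes, if `K(X) → K(X₁)` (the
`K(X)`-algebra `FunctionFieldOver φ`, i.e. `φ♯ = RatFn.functionFieldMap φ`) is formally unramified —
e.g. a separable algebraic extension — then so is the stalk map `𝒪_{X, φ θ} → 𝒪_{X₁, θ} = K(X₁)` at
the generic point `θ` of `X₁`: the two maps agree after composing with the ring isomorphisms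
`𝒪_{X, φ θ} ≅ K(X)` (`φ θ` is the generic point of `X`) and `𝒪_{X₁, θ} ≅ K(X₁)`
(`RatFn.functionFieldMap_toFunctionField`). [cite: DeJong1996, 2.20, p. 61] -/
theorem formallyUnramified_stalkMap_genericPoint_of_formallyUnramified
    [IsIntegral X₁] [IsIntegral X] (φ : X₁ ⟶ X) [IsDominant φ]
    [Algebra.FormallyUnramified X.functionField (FunctionFieldOver φ)] :
    (φ.stalkMap (genericPoint X₁)).hom.FormallyUnramified := by
  have hθ : φ.base (genericPoint X₁) = genericPoint X := genericPoint_eq_of_isDominant φ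
  -- the three maps: `a : 𝒪_{X, φ θ} → K(X)` (bijective), `F = φ♯ : K(X) → K(X₁)` (formally
  -- unramified), `b : 𝒪_{X₁, θ} → K(X₁)` (bijective), with `F ∘ a = b ∘ φ♯_θ`
  set a : X.presheaf.stalk (φ.base (genericPoint X₁)) →+* X.functionField :=
    toFunctionField (φ.base (genericPoint X₁)) with ha_def
  set b : X₁.presheaf.stalk (genericPoint X₁) →+* X₁.functionField :=
    toFunctionField (genericPoint X₁) with hb_def
  have hF : (functionFieldMap φ : X.functionField →+* X₁.functionField).FormallyUnramified := by
    have h := (RingHom.formallyUnramified_algebraMap (R := X.functionField)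
      (S := FunctionFieldOver φ)).mpr inferInstance
    exact h
  -- `b` is the identity `K(X₁) → K(X₁)` (the structure map at the generic point), hence bijective
  have hb : Function.Bijective b := by
    have : b = RingHom.id _ := by
      rw [hb_def]
      change (X₁.presheaf.stalkSpecializes (genericPoint_specializes (genericPoint X₁))).hom = _
      rw [TopCat.Presheaf.stalkSpecializes_refl]
      rfl
    rw [this]
    exact Function.bijective_id
  -- `a` is bijective: injective always, and at `φ θ = ω` it is the structure map at the generic point
  have ha : Function.Bijective a := by
    refine ⟨toFunctionField_injective _, ?_⟩
    rw [ha_def]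
    have key : ∀ x : X, x = genericPoint X → Function.Surjective (toFunctionField x) := by
      rintro x rfl
      have : (toFunctionField (genericPoint X) : X.presheaf.stalk (genericPoint X) →+* _) =
          RingHom.id _ := by
        change (X.presheaf.stalkSpecializes (genericPoint_specializes (genericPoint X))).hom = _
        rw [TopCat.Presheaf.stalkSpecializes_refl]
        rfl
      rw [this]
      exact Function.surjective_id
    exact key _ hθ
  -- `b ∘ φ♯_θ = F ∘ a`
  have hcomp : b.comp (φ.stalkMap (genericPoint X₁)).hom = (functionFieldMap φ).comp a := by
    ext t
    exact (functionFieldMap_toFunctionField φ (genericPoint X₁) t).symm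
  -- hence `φ♯_θ = b⁻¹ ∘ F ∘ a` is formally unramified
  let eb := RingEquiv.ofBijective b hb
  have h1 : ((functionFieldMap φ).comp a).FormallyUnramified :=
    RingHom.FormallyUnramified.comp (.of_surjective ha.2) hF
  have h2 : (eb.symm.toRingHom.comp ((functionFieldMap φ).comp a)).FormallyUnramified :=
    RingHom.FormallyUnramified.comp h1 (.of_surjective eb.symm.surjective)
  have h3 : eb.symm.toRingHom.comp ((functionFieldMap φ).comp a) =
      (φ.stalkMap (genericPoint X₁)).hom := by
    rw [← hcomp, ← RingHom.comp_assoc]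
    ext t
    exact eb.symm_apply_apply _
  rw [h3] at h2
  exact h2

/-- **Separable function field extension ⇒ formally unramified stalk map at the generic point**
(the case `K(X₁)/K(X)` separable of the previous lemma; Mathlib
`Algebra.FormallyUnramified.of_isSeparable`). [cite: DeJong1996, 2.20, p. 61] -/
theorem formallyUnramified_stalkMap_genericPoint_of_isSeparable
    [IsIntegral X₁] [IsIntegral X] (φ : X₁ ⟶ X) [IsDominant φ]
    [Algebra.IsSeparable X.functionField (FunctionFieldOver φ)] :
    (φ.stalkMap (genericPoint X₁)).hom.FormallyUnramified := by
  haveI : Algebra.FormallyUnramified X.functionField (FunctionFieldOver φ) :=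
    Algebra.FormallyUnramified.of_isSeparable _ _
  exact formallyUnramified_stalkMap_genericPoint_of_formallyUnramified φ

/-! ## Alterations -/

namespace IsAlteration

variable [IsIntegral X] {φ : X₁ ⟶ X}

/-- **The generic fibre of an alteration is the generic point**: for an alteration `φ : X₁ → X` and
`z ∈ X₁` with `φ z = ω` the generic point of `X`, `z = θ` is the generic point of `X₁` (over a
non-empty open `U ∋ ω` the morphism is finite, so the fibre over `ω` is discrete, and `θ ⤳ z`).
[cite: DeJong1996, 2.20, p. 61] -/
theorem eq_genericPoint_of_base_eq_genericPoint [IsIntegral X₁] (h : IsAlteration φ) {z : X₁}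
    (hz : φ.base z = genericPoint X) : z = genericPoint X₁ := by
  haveI : IsDominant φ := h.isDominant
  obtain ⟨U, hUne, hfin⟩ := h.exists_isFinite
  haveI := hfin
  have hωU : genericPoint X ∈ U := genericPoint_mem_opens_of_nonempty_aux U hUne
  have hθ : φ.base (genericPoint X₁) = genericPoint X := genericPoint_eq_of_isDominant φ
  have hzU : z ∈ φ ⁻¹ᵁ U := show φ.base z ∈ U by rw [hz]; exact hωU
  have hθU : genericPoint X₁ ∈ φ ⁻¹ᵁ U := show φ.base (genericPoint X₁) ∈ U by rw [hθ]; exact hωU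
  -- in the open subscheme `φ⁻¹U`, `⟨θ⟩ ⤳ ⟨z⟩`, both over `⟨ω⟩`, and the fibre of `φ ∣_ U` is discrete
  let θ' : ↥(φ ⁻¹ᵁ U) := ⟨genericPoint X₁, hθU⟩
  let z' : ↥(φ ⁻¹ᵁ U) := ⟨z, hzU⟩
  have hspec : θ' ⤳ z' :=
    (φ ⁻¹ᵁ U).ι.isOpenEmbedding.isInducing.specializes_iff.mp
      ((genericPoint_spec X₁).specializes (Set.mem_univ z))
  have h1 : (φ ∣_ U).base θ' = ⟨genericPoint X, hωU⟩ :=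
    Subtype.ext (by rw [morphismRestrict_base_coe]; exact hθ)
  have h2 : (φ ∣_ U).base z' = ⟨genericPoint X, hωU⟩ :=
    Subtype.ext (by rw [morphismRestrict_base_coe]; exact hz)
  have key : θ' = z' :=
    ((φ ∣_ U).isDiscrete_preimage_singleton ⟨genericPoint X, hωU⟩).eq_of_specializes hspec h1 h2
  exact (congrArg Subtype.val key).symm

/-- **A separable alteration is finite étale over a non-empty open of the target** (de Jong 1996,
2.20, "⇐", target-sided form: "an alteration `S' → S` is generically étale if ... the (finite)
extension of function fields `R(S) ⊂ R(S')` is separable"; here for `φ` locally of finite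
presentation — automatic for morphisms of finite type to a locally Noetherian scheme).  Proof: the
separable extension `K(X) ⊂ K(X₁)` makes the stalk map at the generic point formally unramified, the
generic fibre is `{θ}`, so `φ` is étale over an open `V₁ ∋ ω` by
`exists_etale_morphismRestrict_of_formallyUnramified_stalkMap_genericPoint`; intersect with an open
over which `φ` is finite. [cite: DeJong1996, 2.20, p. 61] [cite: Grothendieck1967, Thm. 17.6.1 c)⇒a)] -/
theorem exists_isFinite_etale_morphismRestrict_of_isSeparable [LocallyOfFinitePresentation φ]
    (h : IsAlteration φ) (hsep : h.IsSeparable) :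
    ∃ V : X.Opens, (V : Set X).Nonempty ∧ IsFinite (φ ∣_ V) ∧ Etale (φ ∣_ V) := by
  haveI : IsIntegral X₁ := h.isIntegral
  haveI : IsDominant φ := h.isDominant
  haveI : IsProper φ := h.isProper
  haveI : Algebra.IsSeparable X.functionField (FunctionFieldOver φ) := h.isSeparable_iff.mp hsep
  obtain ⟨V₁, hωV₁, hV₁⟩ :=
    exists_etale_morphismRestrict_of_formallyUnramified_stalkMap_genericPoint φ
      (fun z hz => h.eq_genericPoint_of_base_eq_genericPoint hz)
      (formallyUnramified_stalkMap_genericPoint_of_isSeparable φ)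
  obtain ⟨U, hUne, hfin⟩ := h.exists_isFinite
  have hωU : genericPoint X ∈ U := genericPoint_mem_opens_of_nonempty_aux U hUne
  exact ⟨U ⊓ V₁, ⟨genericPoint X, hωU, hωV₁⟩,
    of_morphismRestrict_of_le' @IsFinite φ inf_le_left hfin,
    of_morphismRestrict_of_le' @Etale φ inf_le_right hV₁⟩

/-- **Separable ⇒ generically étale** for alterations (de Jong 1996, 2.20, "⇐", in the source-sided
currency `IsGenericallyEtale` of `AlterationsStrong.lean`: étale on the dense open `φ⁻¹V`).
[cite: DeJong1996, 2.20, p. 61] -/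
theorem isGenericallyEtale_of_isSeparable [LocallyOfFinitePresentation φ] (h : IsAlteration φ)
    (hsep : h.IsSeparable) : IsGenericallyEtale φ := by
  haveI : IsIntegral X₁ := h.isIntegral
  haveI : IsDominant φ := h.isDominant
  obtain ⟨V, hVne, -, hVet⟩ := h.exists_isFinite_etale_morphismRestrict_of_isSeparable hsep
  obtain ⟨x, hx⟩ := hVne
  haveI : Nonempty V := ⟨⟨x, hx⟩⟩
  haveI : Nonempty (φ ⁻¹ᵁ V) := nonempty_preimage_of_isDominant φ V
  refine ⟨φ ⁻¹ᵁ V, (φ ⁻¹ᵁ V).2.dense (Set.nonempty_coe_sort.mp ‹Nonempty (φ ⁻¹ᵁ V)›), ?_⟩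
  rw [← morphismRestrict_ι]
  infer_instance

/-- **De Jong 1996, 2.20**: an alteration (locally of finite presentation) is generically étale if and
only if the extension of function fields `K(X) ⊂ K(X₁)` is separable ("⇒" is ★
`IsAlteration.isSeparable_of_isGenericallyEtale`). [cite: DeJong1996, 2.20, p. 61] -/
theorem isGenericallyEtale_iff_isSeparable [LocallyOfFinitePresentation φ] (h : IsAlteration φ) :
    IsGenericallyEtale φ ↔ h.IsSeparable :=
  ⟨h.isSeparable_of_isGenericallyEtale, h.isGenericallyEtale_of_isSeparable⟩

/-! ## Characteristic zero / perfect function fields -/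

/-- Over a PERFECT function field `K(X)` (e.g. of characteristic `0`) every alteration is separable:
`K(X₁)/K(X)` is a finite, hence algebraic, extension of a perfect field (Mathlib
`Algebra.IsAlgebraic.isSeparable_of_perfectField`). [cite: DeJong1996, 2.20, p. 61] -/
theorem isSeparable_of_perfectField (h : IsAlteration φ) [PerfectField X.functionField] :
    h.IsSeparable := by
  haveI : IsIntegral X₁ := h.isIntegral
  haveI : IsDominant φ := h.isDominant
  haveI : FiniteDimensional X.functionField (FunctionFieldOver φ) :=
    h.finiteDimensional_functionFieldOver
  rw [h.isSeparable_iff]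
  infer_instance

/-- **In characteristic `0` (perfect `K(X)`) every alteration is finite étale over a non-empty open of
the target** — the statement behind "a general fibre of a generically finite dominant morphism of
varieties in characteristic `0` is reduced, with `[K(X₁) : K(X)]` points" (Harris, Prop. 7.16).
[cite: DeJong1996, 2.20, p. 61] [cite: Harris1992, Prop. 7.16] -/
theorem exists_isFinite_etale_morphismRestrict_of_perfectField [LocallyOfFinitePresentation φ]
    (h : IsAlteration φ) [PerfectField X.functionField] :
    ∃ V : X.Opens, (V : Set X).Nonempty ∧ IsFinite (φ ∣_ V) ∧ Etale (φ ∣_ V) :=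
  h.exists_isFinite_etale_morphismRestrict_of_isSeparable h.isSeparable_of_perfectField

/-- Characteristic-`0` spelling of `exists_isFinite_etale_morphismRestrict_of_perfectField`
(`CharZero K(X)`; Mathlib `PerfectField.ofCharZero`). [cite: Harris1992, Prop. 7.16] -/
theorem exists_isFinite_etale_morphismRestrict_of_charZero [LocallyOfFinitePresentation φ]
    (h : IsAlteration φ) [CharZero X.functionField] :
    ∃ V : X.Opens, (V : Set X).Nonempty ∧ IsFinite (φ ∣_ V) ∧ Etale (φ ∣_ V) :=
  h.exists_isFinite_etale_morphismRestrict_of_perfectField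

/-- Over a perfect function field every alteration (locally of finite presentation) is generically
étale (de Jong 1996, 2.20 with `isSeparable_of_perfectField`). [cite: DeJong1996, 2.20, p. 61] -/
theorem isGenericallyEtale_of_perfectField [LocallyOfFinitePresentation φ] (h : IsAlteration φ)
    [PerfectField X.functionField] : IsGenericallyEtale φ :=
  h.isGenericallyEtale_of_isSeparable h.isSeparable_of_perfectField

end IsAlteration

end Literature.AlgebraicGeometry.Resolution

end
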